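import Literature.Analysis.PDE.WeakHarnackNormalized
import HarnessLib

/-!
# The weak Harnack inequality (Gilbarg–Trudinger Theorem 9.22), small-ball form

For a nonnegative `C²` supersolution `a^{ij}D_{ij}u ≤ f` on a ball `B_R(y₀)` of
`EuclideanSpace ℝ ι` (`n = |ι| ≥ 1`), with `λ|ξ|² ≤ a^{ij}ξ_iξ_j ≤ Λ|ξ|²`, `|f| ≤ f₀`, and any
`N > 0` with `N ≥ R² f₀/λ`:

`∫_{B_{αR}(y₀)} (u + N)^p ≤ C Rⁿ (u(x) + N)^p` for every `x ∈ B_{αR}(y₀)` (`weakHarnack`),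

where `α = 1/(4√n)` and `p, C > 0` depend only on `n` and `Λ/λ`. This is GT's (9.52) with average
and infimum taken over the same small concentric ball (which is all the Evans–Krylov argument of
§17.4 uses, cf. (17.49)), `‖f‖_{Lⁿ}` replaced by the sup bound `f₀`, and `ε` absorbed into `N`;
obtained from the normalized statement `setLIntegral_rpow_le_normalized` by the transformation
`x ↦ (x - y₀)/R` and `L ↦ L/λ`.

## References

* D. Gilbarg, N. S. Trudinger, *Elliptic Partial Differential Equations of Second Order* (2001),
  Theorem 9.22, (9.52). [GilbargTrudinger2001]
-/

noncomputable section

open Set InnerProductSpace Matrix Filter Metric MeasureTheory WithLp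
open scoped Topology ENNReal RealInnerProductSpace

namespace Literature.Analysis.PDE.KrylovSafonov

open Literature.Analysis.PDE.ABP Literature.MeasureTheory.Covering.Dyadic

variable {ι : Type*} [Fintype ι] [DecidableEq ι]

/-- The small-ball ratio `α_n = 1/(4√n)`. [cite: GilbargTrudinger2001, proof of Thm 9.22 (α = 1/3n there)] -/
def alphaWH (ι : Type*) [Fintype ι] : ℝ := 1 / (4 * Real.sqrt (Fintype.card ι))

/-- The cutoff exponent parameter `m = ⌈n(Λ/λ)/(2α²)⌉`. [cite: GilbargTrudinger2001, proof of Thm 9.22 (choice of β)] -/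
def mWH (ι : Type*) [Fintype ι] (ratio : ℝ) : ℕ := ⌈Fintype.card ι * ratio / (2 * alphaWH ι ^ 2)⌉₊

/-- **The weak Harnack exponent** `p = p(n, Λ/λ) > 0`. [cite: GilbargTrudinger2001, Thm 9.22] -/
def pWH (ι : Type*) [Fintype ι] (ratio : ℝ) : ℝ := expWH ι 1 ratio (mWH ι ratio) (alphaWH ι)

/-- **The weak Harnack constant** `C = C(n, Λ/λ)`. [cite: GilbargTrudinger2001, Thm 9.22] -/
def CWH (ι : Type*) [Fintype ι] (ratio : ℝ) : ℝ := constWH ι 1 ratio (mWH ι ratio) (alphaWH ι)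

omit [DecidableEq ι] in
/-- `0 < α_n` and `3 α_n √n < 1`. [folklore] -/
theorem alphaWH_pos [Nonempty ι] : 0 < alphaWH ι ∧ 3 * alphaWH ι * Real.sqrt (Fintype.card ι) < 1 := by
  have hn : (0 : ℝ) < Real.sqrt (Fintype.card ι) :=
    Real.sqrt_pos.2 (by exact_mod_cast Fintype.card_pos)
  refine ⟨by unfold alphaWH; positivity, ?_⟩
  unfold alphaWH
  rw [show (3 : ℝ) * (1 / (4 * Real.sqrt (Fintype.card ι))) * Real.sqrt (Fintype.card ι) = 3 / 4 by
    field_simp]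
  norm_num

omit [DecidableEq ι] in
/-- `pair` is homogeneous in the coefficient matrix. [folklore] -/
theorem pair_smul_left (c : ℝ) (a H : Matrix ι ι ℝ) : pair (c • a) H = c * pair a H := by
  simp only [pair, Matrix.smul_apply, smul_eq_mul, Finset.mul_sum]
  refine Finset.sum_congr rfl fun i _ ↦ Finset.sum_congr rfl fun j _ ↦ by ring

/-- **Gilbarg–Trudinger Theorem 9.22 (weak Harnack inequality), small-ball form.**
[cite: GilbargTrudinger2001, Theorem 9.22] -/
theorem weakHarnack [Nonempty ι] {U : Set (EuclideanSpace ℝ ι)} (hU : IsOpen U)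
    {y₀ : EuclideanSpace ℝ ι} {R : ℝ} (hR : 0 < R) (hBU : closedBall y₀ R ⊆ U)
    {u f : EuclideanSpace ℝ ι → ℝ} (hu : ContDiffOn ℝ 2 u U) (hmeas : Measurable u)
    (hu0 : ∀ y ∈ closedBall y₀ R, 0 ≤ u y) {f₀ : ℝ} (hf : ∀ y ∈ ball y₀ R, |f y| ≤ f₀)
    {a : EuclideanSpace ℝ ι → Matrix ι ι ℝ} (ha : ∀ y ∈ ball y₀ R, (a y).IsSymm)
    {lam Λ : ℝ} (hlam0 : 0 < lam)
    (hlam : ∀ y ∈ ball y₀ R, ∀ ξ : ι → ℝ, lam * (ξ ⬝ᵥ ξ) ≤ ξ ⬝ᵥ (a y *ᵥ ξ))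
    (hΛ : ∀ y ∈ ball y₀ R, ∀ ξ : ι → ℝ, ξ ⬝ᵥ (a y *ᵥ ξ) ≤ Λ * (ξ ⬝ᵥ ξ))
    (hsuper : ∀ y ∈ ball y₀ R, pair (a y) (hessianMatrix u (EuclideanSpace.basisFun ι ℝ) y) ≤ f y)
    {N : ℝ} (hN0 : 0 < N) (hNf : R ^ 2 * f₀ / lam ≤ N)
    {x : EuclideanSpace ℝ ι} (hx : x ∈ ball y₀ (alphaWH ι * R)) :
    ∫⁻ y in ball y₀ (alphaWH ι * R), ENNReal.ofReal ((u y + N) ^ pWH ι (Λ / lam)) ≤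
      ENNReal.ofReal (CWH ι (Λ / lam) * R ^ Fintype.card ι * (u x + N) ^ pWH ι (Λ / lam)) := by
  set n := Fintype.card ι with hn
  set α := alphaWH ι with hα
  set ratio := Λ / lam with hratio
  set m := mWH ι ratio with hm
  set p := pWH ι ratio with hp
  obtain ⟨hα0, hρ1⟩ := alphaWH_pos (ι := ι)
  set T := affineMap y₀ R with hT
  -- `Λ ≥ lam > 0` from ellipticity at a nonzero vector
  have hΛlam : lam ≤ Λ := by
    obtain ⟨i⟩ := ‹Nonempty ι›
    have hy₀ : y₀ ∈ ball y₀ R := mem_ball_self hR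
    have h1 := hlam y₀ hy₀ (Pi.single i 1)
    have h2 := hΛ y₀ hy₀ (Pi.single i 1)
    have hvv : (Pi.single i (1 : ℝ) : ι → ℝ) ⬝ᵥ Pi.single i 1 = 1 := by simp
    rw [hvv] at h1 h2
    linarith
  have hratio1 : 1 ≤ ratio := by rw [hratio, le_div_iff₀ hlam0]; linarith
  have hratio0 : 0 ≤ ratio := by linarith
  -- `hβl` for `lam := 1`, `Λ := ratio`
  have hβl : (n : ℝ) * ratio ≤ 2 * (((m + 2 : ℕ) : ℝ) - 1) * 1 * α ^ 2 := by
    have hceil : (n : ℝ) * ratio / (2 * α ^ 2) ≤ m := by rw [hm, mWH]; exact Nat.le_ceil _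
    have h2α : (0 : ℝ) < 2 * α ^ 2 := by positivity
    rw [div_le_iff₀ h2α] at hceil
    have : ((m + 2 : ℕ) : ℝ) - 1 = m + 1 := by push_cast; ring
    rw [this]
    nlinarith
  -- images of balls under `T`
  have hTball : ∀ z : EuclideanSpace ℝ ι, ∀ s : ℝ, T z ∈ ball y₀ (s * R) ↔ z ∈ ball (0 : EuclideanSpace ℝ ι) s := by
    intro z s
    rw [mem_ball, dist_eq_norm, hT, norm_affineMap_sub, abs_of_pos hR, mem_ball_zero_iff]
    constructor
    · intro h; nlinarith
    · intro h; nlinarith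
  have hTball1 : ∀ z : EuclideanSpace ℝ ι, T z ∈ ball y₀ R ↔ z ∈ ball (0 : EuclideanSpace ℝ ι) 1 := by
    intro z; simpa using hTball z 1
  have hTclosed : ∀ z ∈ closedBall (0 : EuclideanSpace ℝ ι) 1, T z ∈ closedBall y₀ R := fun z hz ↦ by
    rw [mem_closedBall, dist_eq_norm, hT, norm_affineMap_sub, abs_of_pos hR]
    have := mem_closedBall_zero_iff.1 hz
    nlinarith
  -- transported data
  set u' : EuclideanSpace ℝ ι → ℝ := u ∘ T with hu'
  set a' : EuclideanSpace ℝ ι → Matrix ι ι ℝ := fun z ↦ lam⁻¹ • a (T z) with ha'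
  set f' : EuclideanSpace ℝ ι → ℝ := fun z ↦ lam⁻¹ * (R ^ 2 * f (T z)) with hf'
  set U' := T ⁻¹' U with hU'
  have hU'o : IsOpen U' := isOpen_preimage_affineMap hU y₀ R
  have hBU' : closedBall (0 : EuclideanSpace ℝ ι) 1 ⊆ U' := fun z hz ↦ hBU (hTclosed z hz)
  have hu'c : ContDiffOn ℝ 2 u' U' := contDiffOn_comp_affineMap hu y₀ R
  have hu'0 : ∀ z ∈ closedBall (0 : EuclideanSpace ℝ ι) 1, 0 ≤ u' z := fun z hz ↦ hu0 _ (hTclosed z hz)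
  have hmeas' : Measurable u' := hmeas.comp (contDiff_affineMap y₀ R).continuous.measurable
  have hf'b : ∀ z ∈ ball (0 : EuclideanSpace ℝ ι) 1, |f' z| ≤ N := fun z hz ↦ by
    rw [hf', abs_mul, abs_inv, abs_of_pos hlam0, abs_mul, abs_of_nonneg (sq_nonneg R)]
    have h1 : |f (T z)| ≤ f₀ := hf _ ((hTball1 z).2 hz)
    calc lam⁻¹ * (R ^ 2 * |f (T z)|) ≤ lam⁻¹ * (R ^ 2 * f₀) := by gcongr
      _ = R ^ 2 * f₀ / lam := by ring
      _ ≤ N := hNf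
  have ha's : ∀ z ∈ ball (0 : EuclideanSpace ℝ ι) 1, (a' z).IsSymm := fun z hz ↦ by
    rw [ha']; exact (ha _ ((hTball1 z).2 hz)).smul _
  have hmul : ∀ z (ξ : ι → ℝ), ξ ⬝ᵥ (a' z *ᵥ ξ) = lam⁻¹ * (ξ ⬝ᵥ (a (T z) *ᵥ ξ)) := fun z ξ ↦ by
    rw [ha', Matrix.smul_mulVec, dotProduct_smul, smul_eq_mul]
  have hlam' : ∀ z ∈ ball (0 : EuclideanSpace ℝ ι) 1, ∀ ξ : ι → ℝ, 1 * (ξ ⬝ᵥ ξ) ≤ ξ ⬝ᵥ (a' z *ᵥ ξ) :=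
    fun z hz ξ ↦ by
      rw [hmul, one_mul, le_inv_mul_iff₀ hlam0]
      exact hlam _ ((hTball1 z).2 hz) ξ
  have hΛ' : ∀ z ∈ ball (0 : EuclideanSpace ℝ ι) 1, ∀ ξ : ι → ℝ, ξ ⬝ᵥ (a' z *ᵥ ξ) ≤ ratio * (ξ ⬝ᵥ ξ) :=
    fun z hz ξ ↦ by
      rw [hmul, hratio, div_eq_inv_mul, mul_assoc]
      exact mul_le_mul_of_nonneg_left (hΛ _ ((hTball1 z).2 hz) ξ) (inv_nonneg.2 hlam0.le)
  have hsuper' : ∀ z ∈ ball (0 : EuclideanSpace ℝ ι) 1,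
      pair (a' z) (hessianMatrix u' (EuclideanSpace.basisFun ι ℝ) z) ≤ f' z := by
    intro z hz
    have hTzB : T z ∈ ball y₀ R := (hTball1 z).2 hz
    have hTzU : T z ∈ U := hBU (ball_subset_closedBall hTzB)
    have hev : ∀ᶠ y in 𝓝 (T z), DifferentiableAt ℝ u y := by
      filter_upwards [hU.mem_nhds hTzU] with y hy
      exact (hu.differentiableOn (by norm_num)).differentiableAt (hU.mem_nhds hy)
    have hu2 : DifferentiableAt ℝ (fderiv ℝ u) (T z) :=
      ((hu.fderiv_of_isOpen hU (m := 1) (by norm_num)).differentiableOn one_ne_zero).differentiableAt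
        (hU.mem_nhds hTzU)
    rw [hu', hessianMatrix_comp_affineMap _ hev hu2, ha', pair_smul_left, pair_smul]
    have h := hsuper _ hTzB
    rw [hf']
    have : 0 ≤ lam⁻¹ * R ^ 2 := by positivity
    nlinarith
  -- apply the normalized statement at `x' = R⁻¹ (x - y₀)`
  set x' : EuclideanSpace ℝ ι := R⁻¹ • (x - y₀) with hx'
  have hTx' : T x' = x := by
    rw [hT, affineMap, hx', smul_smul, mul_inv_cancel₀ hR.ne', one_smul, add_sub_cancel]
  have hx'α : x' ∈ ball (0 : EuclideanSpace ℝ ι) α := by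
    rw [← hTball x' α, hTx']; exact hx
  have hnorm := setLIntegral_rpow_le_normalized hU'o hBU' hu'c hu'0 hmeas' hN0 hf'b ha's one_pos hratio0
    hlam' hΛ' hsuper' hα0 hρ1 hβl hx'α
  -- change of variables `y = T y'`
  have hfin : Module.finrank ℝ (EuclideanSpace ℝ ι) = n := finrank_euclideanSpace
  have hTm : Measurable T := (contDiff_affineMap y₀ R).continuous.measurable
  have hmap : (volume : Measure (EuclideanSpace ℝ ι)) =
      ENNReal.ofReal (R ^ n) • Measure.map T volume := by
    ext A hA
    have hpre : T ⁻¹' A = (fun z : EuclideanSpace ℝ ι ↦ R • z) ⁻¹' ((fun z ↦ y₀ + z) ⁻¹' A) := by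
      ext z; simp [hT, affineMap]
    rw [Measure.smul_apply, Measure.map_apply hTm hA, hpre, Measure.addHaar_preimage_smul volume hR.ne',
      measure_preimage_add, hfin, smul_eq_mul, ← mul_assoc, ← ENNReal.ofReal_mul (by positivity),
      abs_of_pos (by positivity), mul_inv_cancel₀ (by positivity), ENNReal.ofReal_one, one_mul]
  have hG : Measurable fun y : EuclideanSpace ℝ ι ↦ ENNReal.ofReal ((u y + N) ^ p) :=
    ENNReal.measurable_ofReal.comp ((hmeas.add_const N).pow_const p)
  have hpreball : T ⁻¹' ball y₀ (α * R) = ball (0 : EuclideanSpace ℝ ι) α := by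
    ext z; rw [mem_preimage]; exact hTball z α
  calc ∫⁻ y in ball y₀ (α * R), ENNReal.ofReal ((u y + N) ^ p)
      = ENNReal.ofReal (R ^ n) * ∫⁻ z in ball (0 : EuclideanSpace ℝ ι) α,
          ENNReal.ofReal ((u' z + N) ^ p) := by
        conv_lhs => rw [hmap]
        rw [Measure.restrict_smul, lintegral_smul_measure, setLIntegral_map measurableSet_ball hG hTm,
          smul_eq_mul, hpreball]
        rfl
    _ ≤ ENNReal.ofReal (R ^ n) * ENNReal.ofReal (CWH ι ratio * (u' x' + N) ^ p) :=
        mul_le_mul_right hnorm _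
    _ = ENNReal.ofReal (CWH ι ratio * R ^ n * (u x + N) ^ p) := by
        rw [← ENNReal.ofReal_mul (by positivity)]
        congr 1
        have : u' x' = u x := by rw [hu']; simp [hTx']
        rw [this]; ring

end Literature.Analysis.PDE.KrylovSafonov

end
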